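import Summits.ResolutionOfSingularities.ResolutionOfSingularities.Theorems.SharpStrataDefs
import Summits.ResolutionOfSingularities.ResolutionOfSingularities.Theorems.SharpStrataResSepExcIsolatedCore
import Literature.AlgebraicGeometry.Resolution.AlterationsDimension
import Literature.AlgebraicGeometry.Resolution.AlterationsModification
import HarnessLib

/-!
# Crux `SharpStrata.ResSepExc` (stmt-16829): the dimension calibration of the crux and of its
# two registered stubs — the crux is its dimension-`≥ 4` slice, the cut is exact dimension by
# dimension, and the first open case (dimension `4`) is pinned on named statements

The line `Cruxes/ResSepExc/Lines/birth.lean` cuts the crux `ResSepExc` (separably exceptional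
integral varieties over perfect fields of characteristic `p` are resolvable) into the named stub
statements `IsolatedModelsInChar p` (isolated-singularity models) and
`ResolutionOfIsolatedInChar p` (resolution of isolated singularities over perfect fields) of
`Theorems/SharpStrataDefs.lean`, and `resSepExc_iff_stubs` (`SharpStrataResSepExcCalibration`)
shows the cut is exact. This file adds the DIMENSION bookkeeping, every theorem PROVED (no
definition; the bounded-dimension slices are written out with the binders of the named
statements plus one hypothesis `topologicalKrullDim X ≤ d`):

* `topologicalKrullDim_model_eq` — along a proper birational `π : X' → X` between integral
  schemes locally of finite type over a field, `dim X' = dim X` (a modification is an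
  alteration, `IsBirational.isAlteration`; alterations preserve dimension, de Jong 1996, 2.20,
  `IsAlteration.topologicalKrullDim_eq`). This is what makes the cut respect dimension.
* `resSepExc_dimLE_iff_stubs_dimLE` — **the cut is exact in every dimension**: for every bound
  `d` and prime `p`, "`ResSepExc` for `dim X ≤ d`" `↔` "isolated-singularity models for separably
  exceptional `X` with `dim X ≤ d`" `∧` "resolution of isolated singularities for `dim X ≤ d`"
  (all over perfect fields of characteristic `p`).
* `isolatedModels_dimLE_three`, `resolutionOfIsolated_dimLE_three`, `resSepExc_dimLE_three` —
  modulo the named fact `CossartPiltant2019` (resolution in dimension `≤ 3`, every field) both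
  stub slices and the crux slice HOLD for `d = 3`.
* `isolatedModelsInChar_iff_dimGe4`, `resolutionOfIsolatedInChar_iff_dimGe4`,
  `resSepExc_iff_dimGe4` — hence, modulo `CossartPiltant2019`, **each stub statement and the
  crux itself is EQUIVALENT to its slice `¬ dim X ≤ 3`**: the settled dimensions give no
  leverage, a proof must start in dimension `4` and a refutation must live there or above.
* `isolatedModels_dimLE_four_of_finiteSingularModelsDimFour`,
  `resSepExc_dimLE_four_of_finiteSingularModelsDimFour` — **the first open case pinned**: the
  dimension-`≤ 4` slice of the crux follows from the support item
  `IsolatedCore.FiniteSingularModelsDimFour` (stmt-18022, "every fourfold has a model with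
  finitely many singular points", hypotheses `SepExc`/`PerfectField` idle) together with
  resolution of isolated singularities of integral fourfolds over perfect fields (the
  dimension-`4` case of crux `K` = stmt-18021), and conversely the crux slice implies that
  resolution statement (`resolutionOfIsolated_dimLE_of_resSepExc_dimLE`, any `d`).

Net: `ResSepExc` is open exactly from dimension `4`, where it sits between
"K for integral fourfolds over perfect fields" (necessary) and "stmt-18022 ∧ that" (sufficient).
-/

noncomputable section

-- single-problem summit: the doubled namespace component `ResolutionOfSingularities` is forced
set_option linter.dupNamespace false

open CategoryTheory AlgebraicGeometry Literature.AlgebraicGeometry.Resolution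
open Summit.ResolutionOfSingularities.ResolutionOfSingularities.Theses

namespace Summit.ResolutionOfSingularities.ResolutionOfSingularities.Theorems.SharpStrata

/-! ## Dimension is constant along the models of the line -/

/-- **A proper birational model has the same dimension**: if `π : X' → X` is proper and
birational between integral schemes and `X` is locally of finite type over a field `k`, then
`dim X' = dim X` — a modification is an alteration (de Jong 1996, 2.20) and alterations preserve
the dimension of a variety. [cite: DeJong1996, 2.20, p. 61] -/
theorem topologicalKrullDim_model_eq {k : Type} [Field k] {X X' : Scheme.{0}} [IsIntegral X]
    [IsIntegral X'] (f : X ⟶ Spec (.of k)) [LocallyOfFiniteType f] (π : X' ⟶ X) [IsProper π]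
    (hb : IsBirational π) : topologicalKrullDim X' = topologicalKrullDim X :=
  hb.isAlteration.topologicalKrullDim_eq f

/-! ## The cut is exact in every dimension -/

/-- **Bounded-dimension composition.** Fix a prime `p` and a bound `d`. If every separably
exceptional integral separated finite-type `X` of dimension `≤ d` over a perfect field of
characteristic `p` has a proper birational integral model with isolated singularities, and every
such `X` of dimension `≤ d` with isolated singularities is resolvable, then every separably
exceptional such `X` of dimension `≤ d` is resolvable: the model `X'` has `dim X' = dim X ≤ d`
(`topologicalKrullDim_model_eq`), so the second hypothesis resolves it, and the resolution
descends along `π` (`ComponentGluing.Scheme.HasResolution.of_isBirational`). [folklore] -/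
theorem resSepExc_dimLE_of_stubs_dimLE (d : WithBot ℕ∞) {p : ℕ}
    (h₁ : ∀ (k : Type) [Field k] [CharP k p] [PerfectField k] (X : Scheme.{0}) [IsIntegral X]
      (f : X ⟶ Spec (.of k)), IsSeparated f → LocallyOfFiniteType f → QuasiCompact f →
      topologicalKrullDim X ≤ d → SepExc X →
      ∃ (X' : Scheme.{0}) (_ : IsIntegral X') (π : X' ⟶ X),
        IsProper π ∧ IsBirational π ∧ IsolatedSing X')
    (h₂ : ∀ (k : Type) [Field k] [CharP k p] [PerfectField k] (X : Scheme.{0}) [IsIntegral X]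
      (f : X ⟶ Spec (.of k)), IsSeparated f → LocallyOfFiniteType f → QuasiCompact f →
      topologicalKrullDim X ≤ d → IsolatedSing X → Scheme.HasResolution X)
    (k : Type) [Field k] [CharP k p] [PerfectField k] (X : Scheme.{0}) [IsIntegral X]
    (f : X ⟶ Spec (.of k)) [IsSeparated f] [LocallyOfFiniteType f] [QuasiCompact f]
    (hd : topologicalKrullDim X ≤ d) (hX : SepExc X) : Scheme.HasResolution X := by
  obtain ⟨X', hX', π, hπ, hb, hiso⟩ := h₁ k X f ‹_› ‹_› ‹_› hd hX
  haveI := hX'; haveI := hπ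
  refine ComponentGluing.Scheme.HasResolution.of_isBirational π hb ?_
  have hd' : topologicalKrullDim X' ≤ d := (topologicalKrullDim_model_eq f π hb).le.trans hd
  exact h₂ k X' (π ≫ f) inferInstance inferInstance inferInstance hd' hiso

/-- **The crux slice gives the model slice**: a resolution `π : X' → X` of a separably
exceptional `X` of dimension `≤ d` is an isolated-singularity model (`X'` regular ⇒ reduced ⇒
integral over the integral `X`; regular ⇒ isolated singularities). [folklore] -/
theorem isolatedModels_dimLE_of_resSepExc_dimLE (d : WithBot ℕ∞) {p : ℕ}
    (h : ∀ (k : Type) [Field k] [CharP k p] [PerfectField k] (X : Scheme.{0}) [IsIntegral X]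
      (f : X ⟶ Spec (.of k)), IsSeparated f → LocallyOfFiniteType f → QuasiCompact f →
      topologicalKrullDim X ≤ d → SepExc X → Scheme.HasResolution X)
    (k : Type) [Field k] [CharP k p] [PerfectField k] (X : Scheme.{0}) [IsIntegral X]
    (f : X ⟶ Spec (.of k)) [IsSeparated f] [LocallyOfFiniteType f] [QuasiCompact f]
    (hd : topologicalKrullDim X ≤ d) (hX : SepExc X) :
    ∃ (X' : Scheme.{0}) (_ : IsIntegral X') (π : X' ⟶ X),
      IsProper π ∧ IsBirational π ∧ IsolatedSing X' := by
  obtain ⟨X', π, hπ⟩ := h k X f ‹_› ‹_› ‹_› hd hX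
  haveI : IsReduced X' := hπ.isRegular.isReduced
  exact ⟨X', hπ.isBirational.isIntegral, π, hπ.isProper, hπ.isBirational,
    isolatedSing_of_isRegular hπ.isRegular⟩

/-- **The crux slice gives the resolution-of-isolated-singularities slice** (a variety with
isolated singularities is separably exceptional, `IsolatedSing.sepExc`). [folklore] -/
theorem resolutionOfIsolated_dimLE_of_resSepExc_dimLE (d : WithBot ℕ∞) {p : ℕ}
    (h : ∀ (k : Type) [Field k] [CharP k p] [PerfectField k] (X : Scheme.{0}) [IsIntegral X]
      (f : X ⟶ Spec (.of k)), IsSeparated f → LocallyOfFiniteType f → QuasiCompact f →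
      topologicalKrullDim X ≤ d → SepExc X → Scheme.HasResolution X)
    (k : Type) [Field k] [CharP k p] [PerfectField k] (X : Scheme.{0}) [IsIntegral X]
    (f : X ⟶ Spec (.of k)) [IsSeparated f] [LocallyOfFiniteType f] [QuasiCompact f]
    (hd : topologicalKrullDim X ≤ d) (hX : IsolatedSing X) : Scheme.HasResolution X :=
  h k X f ‹_› ‹_› ‹_› hd hX.sepExc

/-- **The cut of line `birth` is exact in every dimension.** For every bound `d` and prime `p`:
"`ResSepExc` for separably exceptional `X` with `dim X ≤ d`" is EQUIVALENT to the conjunction of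
"isolated-singularity models for separably exceptional `X` with `dim X ≤ d`" and "resolution of
`X` with isolated singularities and `dim X ≤ d`" (everything over perfect fields of
characteristic `p`). So the first open dimension of the crux is the first open dimension of one
of its stubs, and conversely. [folklore] -/
theorem resSepExc_dimLE_iff_stubs_dimLE (d : WithBot ℕ∞) (p : ℕ) :
    (∀ (k : Type) [Field k] [CharP k p] [PerfectField k] (X : Scheme.{0}) [IsIntegral X]
      (f : X ⟶ Spec (.of k)), IsSeparated f → LocallyOfFiniteType f → QuasiCompact f →
      topologicalKrullDim X ≤ d → SepExc X → Scheme.HasResolution X) ↔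
    (∀ (k : Type) [Field k] [CharP k p] [PerfectField k] (X : Scheme.{0}) [IsIntegral X]
      (f : X ⟶ Spec (.of k)), IsSeparated f → LocallyOfFiniteType f → QuasiCompact f →
      topologicalKrullDim X ≤ d → SepExc X →
      ∃ (X' : Scheme.{0}) (_ : IsIntegral X') (π : X' ⟶ X),
        IsProper π ∧ IsBirational π ∧ IsolatedSing X') ∧
    (∀ (k : Type) [Field k] [CharP k p] [PerfectField k] (X : Scheme.{0}) [IsIntegral X]
      (f : X ⟶ Spec (.of k)), IsSeparated f → LocallyOfFiniteType f → QuasiCompact f →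
      topologicalKrullDim X ≤ d → IsolatedSing X → Scheme.HasResolution X) := by
  refine ⟨fun h => ⟨fun k _ _ _ X _ f hs hl hq hd hX => ?_, fun k _ _ _ X _ f hs hl hq hd hX => ?_⟩,
    fun h k _ _ _ X _ f hs hl hq hd hX => ?_⟩
  · haveI := hs; haveI := hl; haveI := hq
    exact isolatedModels_dimLE_of_resSepExc_dimLE d h k X f hd hX
  · haveI := hs; haveI := hl; haveI := hq
    exact resolutionOfIsolated_dimLE_of_resSepExc_dimLE d h k X f hd hX
  · haveI := hs; haveI := hl; haveI := hq
    exact resSepExc_dimLE_of_stubs_dimLE d h.1 h.2 k X f hd hX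

/-! ## Dimension `≤ 3`: both stub slices and the crux slice hold (modulo `CossartPiltant2019`) -/

/-- **Resolution of isolated singularities in dimension `≤ 3`** (indeed of every integral
separated finite-type `X` of dimension `≤ 3` over any field; the hypothesis `IsolatedSing X` is
idle), modulo the named fact `CossartPiltant2019`. [cite: CossartPiltant2019, Thm. 1.1] -/
theorem resolutionOfIsolated_dimLE_three (h : CossartPiltant2019.{0}) {p : ℕ} (k : Type)
    [Field k] [CharP k p] (X : Scheme.{0}) [IsIntegral X] (f : X ⟶ Spec (.of k))
    [IsSeparated f] [LocallyOfFiniteType f] [QuasiCompact f] (hd : topologicalKrullDim X ≤ 3) :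
    Scheme.HasResolution X :=
  hasResolution_of_dim_le_three h (p := p) k X f hd

/-- **Isolated-singularity models in dimension `≤ 3`** (for every integral separated
finite-type `X` of dimension `≤ 3` over any field; `SepExc X` idle), modulo `CossartPiltant2019`:
a resolution is such a model. [cite: CossartPiltant2019, Thm. 1.1] -/
theorem isolatedModels_dimLE_three (h : CossartPiltant2019.{0}) {p : ℕ} (k : Type) [Field k]
    [CharP k p] (X : Scheme.{0}) [IsIntegral X] (f : X ⟶ Spec (.of k)) [IsSeparated f]
    [LocallyOfFiniteType f] [QuasiCompact f] (hd : topologicalKrullDim X ≤ 3) :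
    ∃ (X' : Scheme.{0}) (_ : IsIntegral X') (π : X' ⟶ X),
      IsProper π ∧ IsBirational π ∧ IsolatedSing X' := by
  obtain ⟨X', π, hπ⟩ := hasResolution_of_dim_le_three h (p := p) k X f hd
  haveI : IsReduced X' := hπ.isRegular.isReduced
  exact ⟨X', hπ.isBirational.isIntegral, π, hπ.isProper, hπ.isBirational,
    isolatedSing_of_isRegular hπ.isRegular⟩

/-- **The crux in dimension `≤ 3`** (`SepExc X` and `PerfectField k` idle), modulo
`CossartPiltant2019`. [cite: CossartPiltant2019, Thm. 1.1] -/
theorem resSepExc_dimLE_three (h : CossartPiltant2019.{0}) {p : ℕ} (k : Type) [Field k]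
    [CharP k p] (X : Scheme.{0}) [IsIntegral X] (f : X ⟶ Spec (.of k)) [IsSeparated f]
    [LocallyOfFiniteType f] [QuasiCompact f] (hd : topologicalKrullDim X ≤ 3) :
    Scheme.HasResolution X :=
  hasResolution_of_dim_le_three h (p := p) k X f hd

/-! ## Hence the crux, and each stub, is its dimension-`≥ 4` slice (modulo `CossartPiltant2019`) -/

/-- **The model stub is its dimension-`≥ 4` slice**: modulo `CossartPiltant2019`,
`IsolatedModelsInChar p` is equivalent to the same statement for `X` with `¬ dim X ≤ 3`.
[folklore] -/
theorem isolatedModelsInChar_iff_dimGe4 (h : CossartPiltant2019.{0}) (p : ℕ) :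
    IsolatedModelsInChar p ↔
      ∀ (k : Type) [Field k] [CharP k p] [PerfectField k] (X : Scheme.{0}) [IsIntegral X]
        (f : X ⟶ Spec (.of k)), IsSeparated f → LocallyOfFiniteType f → QuasiCompact f →
        ¬ topologicalKrullDim X ≤ 3 → SepExc X →
        ∃ (X' : Scheme.{0}) (_ : IsIntegral X') (π : X' ⟶ X),
          IsProper π ∧ IsBirational π ∧ IsolatedSing X' := by
  refine ⟨fun H k _ _ _ X _ f hs hl hq _ hX => H k X f hs hl hq hX,
    fun H k _ _ _ X _ f hs hl hq hX => ?_⟩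
  by_cases hd : topologicalKrullDim X ≤ 3
  · haveI := hs; haveI := hl; haveI := hq
    exact isolatedModels_dimLE_three h (p := p) k X f hd
  · exact H k X f hs hl hq hd hX

/-- **The resolution stub is its dimension-`≥ 4` slice**: modulo `CossartPiltant2019`,
`ResolutionOfIsolatedInChar p` is equivalent to the same statement for `X` with `¬ dim X ≤ 3`
(resolution of isolated singularities of integral varieties of dimension `≥ 4` over perfect
fields of characteristic `p`). [folklore] -/
theorem resolutionOfIsolatedInChar_iff_dimGe4 (h : CossartPiltant2019.{0}) (p : ℕ) :
    ResolutionOfIsolatedInChar p ↔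
      ∀ (k : Type) [Field k] [CharP k p] [PerfectField k] (X : Scheme.{0}) [IsIntegral X]
        (f : X ⟶ Spec (.of k)), IsSeparated f → LocallyOfFiniteType f → QuasiCompact f →
        ¬ topologicalKrullDim X ≤ 3 → IsolatedSing X → Scheme.HasResolution X := by
  refine ⟨fun H k _ _ _ X _ f hs hl hq _ hX => H k X f hs hl hq hX,
    fun H k _ _ _ X _ f hs hl hq hX => ?_⟩
  by_cases hd : topologicalKrullDim X ≤ 3
  · haveI := hs; haveI := hl; haveI := hq
    exact resolutionOfIsolated_dimLE_three h (p := p) k X f hd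
  · exact H k X f hs hl hq hd hX

/-- **The crux `ResSepExc` is its dimension-`≥ 4` slice** (modulo `CossartPiltant2019`):
`ResSepExc ↔` "for every prime `p`, every perfect field `k` of characteristic `p` and every
separably exceptional integral separated finite-type `X/k` with `¬ dim X ≤ 3`, `X` has a
resolution". The settled dimensions give no leverage on the crux: a proof must begin with
fourfolds, a refutation must exhibit a separably exceptional variety of dimension `≥ 4` (e.g.
one with an isolated singular point) without resolution. [cite: CossartPiltant2019, Thm. 1.1] -/
theorem resSepExc_iff_dimGe4 (h : CossartPiltant2019.{0}) :
    SharpStrata.ResSepExc ↔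
      ∀ p : ℕ, p.Prime → ∀ (k : Type) [Field k] [CharP k p] [PerfectField k] (X : Scheme.{0})
        [IsIntegral X] (f : X ⟶ Spec (.of k)), IsSeparated f → LocallyOfFiniteType f →
        QuasiCompact f → ¬ topologicalKrullDim X ≤ 3 → SepExc X → Scheme.HasResolution X := by
  refine ⟨fun H p hp k _ _ _ X _ f hs hl hq _ hX => H p hp k X f hs hl hq hX,
    fun H p hp k _ _ _ X _ f hs hl hq hX => ?_⟩
  by_cases hd : topologicalKrullDim X ≤ 3
  · haveI := hs; haveI := hl; haveI := hq
    exact resSepExc_dimLE_three h (p := p) k X f hd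
  · exact H p hp k X f hs hl hq hd hX

/-! ## The first open case, dimension `4`, pinned on named statements -/

/-- **Stmt-18022 gives the model stub for fourfolds** (`SepExc X`, `PerfectField k` idle):
`IsolatedCore.FiniteSingularModelsDimFour` hands every integral separated finite-type `X` of
dimension `≤ 4` over a field of characteristic `p` a proper birational reduced — hence integral —
model with finitely many non-regular points, every point of which is therefore regular or closed
(`regular_or_isClosed_of_finite_nonRegular`). [folklore] -/
theorem isolatedModels_dimLE_four_of_finiteSingularModelsDimFour
    (hW : IsolatedCore.FiniteSingularModelsDimFour) {p : ℕ} (hp : p.Prime) (k : Type) [Field k]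
    [CharP k p] (X : Scheme.{0}) [IsIntegral X] (f : X ⟶ Spec (.of k)) [IsSeparated f]
    [LocallyOfFiniteType f] [QuasiCompact f] (hd : topologicalKrullDim X ≤ 4) :
    ∃ (X' : Scheme.{0}) (_ : IsIntegral X') (π : X' ⟶ X),
      IsProper π ∧ IsBirational π ∧ IsolatedSing X' := by
  obtain ⟨X', π, hπ, hb, hred, hfin⟩ := hW p hp k X f ‹_› ‹_› ‹_› inferInstance hd
  haveI := hred; haveI := hπ
  haveI : IsIntegral X' := hb.isIntegral
  exact ⟨X', inferInstance, π, hπ, hb, regular_or_isClosed_of_finite_nonRegular X' (π ≫ f) hfin⟩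

/-- **The dimension-`≤ 4` slice of the crux from stmt-18022 and resolution of isolated
singularities of fourfolds.** If every reduced fourfold over a field of characteristic `p` has a
model with finitely many singular points (`IsolatedCore.FiniteSingularModelsDimFour`, stmt-18022)
and every integral separated finite-type `X` of dimension `≤ 4` over a perfect field of
characteristic `p` with isolated singularities is resolvable (the dimension-`4` case of crux `K`,
stmt-18021), then `ResSepExc` holds for every separably exceptional `X` of dimension `≤ 4`
(`resSepExc_dimLE_of_stubs_dimLE` at `d = 4`; with `resSepExc_iff_dimGe4` this is the whole
first open case of the crux). [folklore] -/
theorem resSepExc_dimLE_four_of_finiteSingularModelsDimFour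
    (hW : IsolatedCore.FiniteSingularModelsDimFour) {p : ℕ} (hp : p.Prime)
    (hK : ∀ (k : Type) [Field k] [CharP k p] [PerfectField k] (X : Scheme.{0}) [IsIntegral X]
      (f : X ⟶ Spec (.of k)), IsSeparated f → LocallyOfFiniteType f → QuasiCompact f →
      topologicalKrullDim X ≤ 4 → IsolatedSing X → Scheme.HasResolution X)
    (k : Type) [Field k] [CharP k p] [PerfectField k] (X : Scheme.{0}) [IsIntegral X]
    (f : X ⟶ Spec (.of k)) [IsSeparated f] [LocallyOfFiniteType f] [QuasiCompact f]
    (hd : topologicalKrullDim X ≤ 4) (hX : SepExc X) : Scheme.HasResolution X :=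
  resSepExc_dimLE_of_stubs_dimLE 4
    (fun k _ _ _ X _ f hs hl hq hd _ => by
      haveI := hs; haveI := hl; haveI := hq
      exact isolatedModels_dimLE_four_of_finiteSingularModelsDimFour hW hp k X f hd)
    hK k X f hd hX

end Summit.ResolutionOfSingularities.ResolutionOfSingularities.Theorems.SharpStrata

end
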